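import Summits.ResolutionOfSingularities.ResolutionOfSingularities.Theorems.EquisingularLiftEquisingularLiftNatTowerBFourSecRound
import Summits.ResolutionOfSingularities.ResolutionOfSingularities.Theorems.EquisingularLiftEquisingularLiftNatNoseTowerBTriplePrimeOfFact
import Summits.ResolutionOfSingularities.ResolutionOfSingularities.Theorems.EquisingularLiftEquisingularLiftNatResidueHypDefsE6
import HarnessLib

/-!
# [OURS · L1 W4.5(b) · EL♮(3) · WIDTH TABLE D12 «NOSE CREASE / SECTION ROUND», engine delta — tail closure] THE Σ-SECTION TAIL RULE ON THE B‴ NOSE TOWER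
# `Tower.towerSecRoundSigma_invB₁_of_licence` (fourth closure of `INV₁‴`) and `hsub_reachNoseTowerBTriplePrimeSigma_of_fact'` (HSUB‴ with the Σ tail)

res-L1-w45b-stub-4 g15 (desk RULING R74 (i) D12-PRE; filing gated on the D12 DEAL (027 files `…NatResidueHypDefsE6` then) + res-L1-w45b-nose-w1's (B)/cap).
WHAT.  The D12 doors `ReachDirectPlanarNoseSigma₂` / `ReachDirectCINoseSigma₂` (res-type-027) are the direct doors with ONE insert in the inline `∀R`-tail:
`TowerSecRoundSigma ℙ F₃ υ' Z hZ R →` after `TowerRoundBTriplePrime … R →`.  To consume such a tail upstairs, the tower motive `INV₁‴` of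
✓ `hsub_reachNoseTowerBTriplePrime_of_fact'` must be closed under the new rule as well: (1) `Tower.towerSecRoundSigma_invB₁_of_licence` proves it — the Σ rule
is branch 1 of ✓ `TowerRoundBTriplePrime` («host = the running surface `E`, shadow `K`») with (N1)+(L2)+(L3)+(N3) for the admissibility letters, so its dispatch is
that branch's multisection case over `Tower.invB₄_secRound_of_licence` (`…NatTowerBFourSecRound`, the embedded-lift round re-licensed) and the regularity-free
✓ `Tower.invB₄_coneRound_of_anyPrime` for the `ConeWitness` shadow alternative; (2) `hsub_reachNoseTowerBTriplePrimeSigma_of_fact'` = ✓ `…_of_fact'` with the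
tail antecedent added and discharged by (1).  The Σ-licence `hSL` (stub-2's binder 0196e0c85d2c112d at `(O, k, θ)`) is the one new hypothesis; it becomes a TERM
on (B)-day (nose-w1's cap), exactly as RUNG⁹ feeds `TCPlus.hround_sec`.
OURS; NOT a statement of any manuscript ([Hironaka2017] is a candidate under adjudication, nothing of it is asserted); AI-written, weaker than expert review.
No `sorry`; standard axioms; DEF-FREE.  `--supports stmt-ResolutionOfSingularities-20148 --as helper`.  EL♮(3) is NOT proved by this file.
[cite: StacksProject, Tag 02NS and Tag 02OS] [cite: Liu2002, Thm. 8.1.19] [folklore; ✓ T23-A‴ engine (this seat g11/g12) + one closure]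
-/

set_option linter.dupNamespace false -- mandated namespace `Summit.<Summit>.<Problem>` of this single-conjunct summit
set_option linter.overlappingInstances false -- signatures carry `[IsDomain O] [IsDiscreteValuationRing O]`

noncomputable section

open CategoryTheory CategoryTheory.Limits AlgebraicGeometry TopologicalSpace Topology IsLocalRing
open Literature.AlgebraicGeometry.Resolution
open AlgebraicGeometry.Scheme.IdealSheafData
open Summit.ResolutionOfSingularities.ResolutionOfSingularities.Theses.EquisingularLift.Split
open Summit.ResolutionOfSingularities.ResolutionOfSingularities.Cruxes.EquisingularLift.StrataSplit

namespace Summit.ResolutionOfSingularities.ResolutionOfSingularities.Cruxes.EquisingularLiftNat.Sections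

section Closure

variable (O : Type) [CommRing O] [IsDomain O] [IsDiscreteValuationRing O] (k : Type) [Field k]
    (θ : O →+* k) (hθ : Function.Surjective θ)
    (P : Scheme.{0}) [IsIntegral P] (q : P ⟶ Spec (.of O)) [IsProper q] [SmoothOfRelativeDimension 3 q] (Y : Set P)
    (hYsp : Y ⊆ q ⁻¹' {IsLocalRing.closedPoint O}) (hYirr : IsIrreducible Y) (hYcl : IsClosed Y)
    (hPnoeth : IsLocallyNoetherian P) (hPreg : Scheme.IsRegular P)
    (Ch : ∀ X' : Scheme.{0}, (X' ⟶ P) → Set X' → Prop)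
    (hChStep : ∀ (X' X'' : Scheme.{0}) (σ' : X' ⟶ P) (S' : Set X') (C : X'.IdealSheafData) (τ : X'' ⟶ X'),
      Ch X' σ' S' → IsBlowup τ C → Scheme.IsRegular C.subscheme → Flat (C.subschemeι ≫ σ' ≫ q) →
      σ' '' (C.support : Set X') ⊆ {y | ¬ IsGenericPoint y Y} → (C.support : Set X') ∩ (σ' ≫ q) ⁻¹' {IsLocalRing.closedPoint O} ⊆ S' →
      Ch X'' (τ ≫ σ') (closure (τ ⁻¹' (S' \ (C.support : Set X')))))
    (hChSplit : ∀ (X' : Scheme.{0}) (σ' : X' ⟶ P) (S' : Set X'), Ch X' σ' S' → Chain P Y X' σ' S')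

include hθ hYsp hYirr hYcl hPnoeth hPreg hChStep hChSplit

set_option maxHeartbeats 400000 in
/-- ★★ **THE FOURTH CLOSURE OF THE B‴ NOSE TOWER: `TowerSecRoundSigma` on `INV₁‴`** (WIDTH TABLE D12 engine delta; in the shape of the tower assembly V10⁗,
`INV₁‴` with the extra conjunct `IsLocallyNoetherian F₉`, as ✓ `Tower.towerRoundBTriplePrime_invB₄_of_fact'`).  The Σ tail rule = branch 1 of
✓ `TowerRoundBTriplePrime` with the admissibility letters replaced by (N1)+(L2)+(L3)+(N3); dispatched exactly as that branch's «GENUS-FREE MULTISECTION round»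
case (✓ :167–:174): `Tower.invB₄_secRound_of_licence` (host `E`, shadow `K`) for the two embedded-lift shadow alternatives, ✓ `Tower.invB₄_coneRound_of_anyPrime`
(regularity-free) for the `ConeWitness` alternative; `Es'` menu by the `W = Hst = E` fold of ✓ `hEs'1_of`, `Ns'` menu by ✓ `Tower.ns'_menu_of_append`.
The Σ-licence `hSL` (res-L1-w45b-stub-2's binder at `(O, k, θ)`) is the ONLY hypothesis beyond the V10⁗ context.
[OURS · L1 W4.5b · WIDTH TABLE D12 «NOSE CREASE / SECTION ROUND», desk R74 (i)]; NOT a statement of the manuscript; EL♮(3) NOT proved. -/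
theorem Tower.towerSecRoundSigma_invB₁_of_licence
    (hSL :
      ∀ {P : Scheme.{0}} (X : Scheme.{0}) (σ : X ⟶ P) (q : P ⟶ Spec (.of O)) (𝓔 : X.IdealSheafData),
        IsIntegral X → IsLocallyNoetherian X → Scheme.IsRegular X → IsProper (σ ≫ q) →
        (∀ x : X, (stalkIdeal 𝓔 x).IsPrincipal) → 𝓔 ≠ ⊥ →
        Scheme.IsRegular 𝓔.subscheme → Flat (𝓔.subschemeι ≫ σ ≫ q) → IsProper (𝓔.subschemeι ≫ σ ≫ q) →
        ∀ (G : Scheme.{0}) (j : G ⟶ X) (t : G ⟶ Spec (.of k)),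
          IsPullback j t (σ ≫ q) (Spec.map (CommRingCat.ofHom θ)) →
          ∀ (E : Set G) (hE : IsClosed E), 𝓔.comap j = vanishingIdeal (⟨E, hE⟩ : Closeds G) →
          ∀ (Z : Set G) (hZ : IsClosed Z), Z ⊆ E →
            Set.Finite {x : ↥(redSub G Z hZ) | ¬ IsRegularLocalRing ((redSub G Z hZ).presheaf.stalk x)} →
            (∀ z : ↥(redSub G Z hZ), IsClosed ({z} : Set ↥(redSub G Z hZ)) →
              ringKrullDim ((redSub G Z hZ).presheaf.stalk z) = ((1 : ℕ) : WithBot ℕ∞)) →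
            (∀ (i : redSub G Z hZ ⟶ redSub G E hE), i ≫ redSubι G E hE = redSubι G Z hZ →
              ∀ z : ↥(redSub G Z hZ), IsClosed ({z} : Set ↥(redSub G Z hZ)) →
                ringKrullDim ((redSub G E hE).presheaf.stalk (i z)) = ((2 : ℕ) : WithBot ℕ∞)) →
            (∀ z ∈ Z, IsClosed ({z} : Set G) → ∃ f : G.presheaf.stalk z,
              stalkIdeal (vanishingIdeal (⟨Z, hZ⟩ : Closeds G)) z =
                  stalkIdeal (vanishingIdeal (⟨E, hE⟩ : Closeds G)) z ⊔ Ideal.span {f} ∧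
                f ∉ stalkIdeal (vanishingIdeal (⟨E, hE⟩ : Closeds G)) z ⊔ (maximalIdeal (G.presheaf.stalk z)) ^ 2) →
            DirStepUnobs G E hE Z hZ →
            ∃ C : X.IdealSheafData, 𝓔 ≤ C ∧ Scheme.IsRegular C.subscheme ∧ Flat (C.subschemeι ≫ σ ≫ q) ∧
              C.comap j = vanishingIdeal (⟨Z, hZ⟩ : Closeds G)) :
    ∀ {F₉ : Scheme.{0}} (Z₉ : Set F₉) (hZ₉ : IsClosed Z₉) {F₁₀ : Scheme.{0}} (υ' : F₁₀ ⟶ F₉),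
      TowerSecRoundSigma F₉ F₁₀ υ' Z₉ hZ₉ (fun G γ T E Es Ns K =>
        (Tower.InvB₄ O k θ P q Y Ch (fun _ _ _ _ _ _ _ _ _ σ _ 𝓔 => Flat (𝓔.subschemeι ≫ σ ≫ q)) F₉ Z₉ hZ₉ F₁₀ υ' G γ T E Es Ns K ∧
          IsClosed K ∧ K ⊆ closure (K \ E) ∧ K ≠ Set.univ) ∧
        (∀ z : ↥(redSub F₉ Z₉ hZ₉), IsClosed ({z} : Set ↥(redSub F₉ Z₉ hZ₉)) →
          ringKrullDim ((redSub F₉ Z₉ hZ₉).presheaf.stalk z) = ((1 : ℕ) : WithBot ℕ∞)) ∧ IsLocallyNoetherian F₉) := by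
  intro F₉ Z₉ hZ₉ F₁₀ υ' G G' γ T E Es Ns K hE Z hZ υ₂ K' E' Es' Ns' hinv hZET hZne hTZ hZfin hL2 hunobs hZdim hυ₂ hE' hK' hEs' hNs'
  obtain ⟨hI, hcar, hF₉noeth⟩ := hinv
  haveI := hF₉noeth
  have hEmbB := Tower.invB₄_secRound_of_licence O k θ hθ P q Y hYsp hYirr hYcl hPnoeth hPreg Ch hChStep hChSplit hSL Z₉ hZ₉ υ'
  have hConeB := Tower.invB₄_coneRound_of_anyPrime O k θ hθ P q Y hYirr hYcl hPnoeth hPreg Ch hChStep hChSplit Z₉ hZ₉ υ'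
  have hNs'' := Tower.ns'_menu_of_append hNs'
  -- the B′-shape `Es'` menu (host = witness = the running surface)
  have hEs'1 : ∀ F' ∈ Es', ∃ F ∈ E :: Es, RoundTransportOKPrime υ₂ Z hZ E F F' := fun F' hF' => by
    obtain ⟨F, hF, h1, h2⟩ := hEs' F' hF'
    refine ⟨F, hF, ?_, h2⟩
    rcases h1 with h | h | h | h
    · exact Or.inl h
    · exact Or.inl h
    · exact Or.inr (Or.inl h)
    · exact Or.inr (Or.inr h)
  rcases hK' with hK0 | ⟨hcone | hoff, hKst⟩
  · exact (fun h => ⟨h, hcar, hF₉noeth⟩) (hEmbB G G' γ T E Es Ns K E K hE Z hZ υ₂ K' E' Es' Ns' hI (Or.inl ⟨rfl, rfl⟩) hZET hZne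
      hZfin hL2 hunobs hZdim hυ₂ (Or.inl hK0) hE' hEs'1 hNs'')
  · exact (fun h => ⟨h, hcar, hF₉noeth⟩) (hConeB G G' γ T E Es Ns K hE Z hZ υ₂ K' E' Es' Ns' hI hZET hZne hcone hυ₂ (Or.inr hKst) hE' hEs'1 hNs'')
  · exact (fun h => ⟨h, hcar, hF₉noeth⟩) (hEmbB G G' γ T E Es Ns K E K hE Z hZ υ₂ K' E' Es' Ns' hI (Or.inl ⟨rfl, rfl⟩) hZET hZne
      hZfin hL2 hunobs hZdim hυ₂ (Or.inr ⟨hoff, hKst⟩) hE' hEs'1 hNs'')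

end Closure

/-- ★★ **HSUB‴Σ — THE B‴ NOSE-TOWER ENGINE WITH THE Σ-SECTION TAIL RULE** (WIDTH TABLE D12 engine delta): ✓ `hsub_reachNoseTowerBTriplePrime_of_fact'`
(res-L1-w45b-stub-4 g11/g12, nose-w2 re-cut) VERBATIM with ONE more antecedent `TowerSecRoundSigma F₁ F₂ υ Z hZ R₁ →` in the tail's closure hypothesis
(027's `ReachDirect…Sigma₂` doors, `DefsE6_D12_draft.lean` f05bcd1dec52a873) discharged by the fourth closure `Tower.towerSecRoundSigma_invB₁_of_licence`,
and ONE more hypothesis, the Σ-licence `hSL` at `(O, k, θ)`. [OURS · L1 W4.5b · desk R74 (i)]; NOT a statement of the manuscript; EL♮(3) NOT proved. -/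
theorem hsub_reachNoseTowerBTriplePrimeSigma_of_fact' (k : Type) [Field k]
    (O : Type) [CommRing O] [IsDomain O] [IsDiscreteValuationRing O] [IsAdicComplete (IsLocalRing.maximalIdeal O) O]
    [IsAlgClosed (IsLocalRing.ResidueField O)] (θ : O →+* k) (hθ : Function.Surjective θ)
    (P : Scheme.{0}) (q : P ⟶ Spec (.of O)) (Y : Set P) (Ch : ∀ X' : Scheme.{0}, (X' ⟶ P) → Set X' → Prop)
    (hChStep : ∀ (X' X'' : Scheme.{0}) (σ' : X' ⟶ P) (S' : Set X') (C : X'.IdealSheafData) (τ : X'' ⟶ X'),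
      Ch X' σ' S' → IsBlowup τ C → Scheme.IsRegular C.subscheme → Flat (C.subschemeι ≫ σ' ≫ q) →
      σ' '' (C.support : Set X') ⊆ {y | ¬ IsGenericPoint y Y} → (C.support : Set X') ∩ (σ' ≫ q) ⁻¹' {IsLocalRing.closedPoint O} ⊆ S' →
      Ch X'' (τ ≫ σ') (closure (τ ⁻¹' (S' \ (C.support : Set X')))))
    (hChSplit : ∀ (X' : Scheme.{0}) (σ' : X' ⟶ P) (S' : Set X'), Ch X' σ' S' → Chain P Y X' σ' S')
    (hYsp : Y ⊆ q ⁻¹' {IsLocalRing.closedPoint O}) (hYirr : IsIrreducible Y) (hYcl : IsClosed Y) (hPint : IsIntegral P)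
    (hPnoeth : IsLocallyNoetherian P) (hPreg : Scheme.IsRegular P) (hqprop : IsProper q) (hqsm : SmoothOfRelativeDimension 3 q)
    -- the stage before the nose and its model
    (X' : Scheme.{0}) (σ' : X' ⟶ P) (S' : Set X') (_hCh' : Ch X' σ' S') (_hX'int : IsIntegral X') (hX'noeth : IsLocallyNoetherian X')
    (hX'reg : Scheme.IsRegular X') (_hX'dom : IsDominant (σ' ≫ q)) (F₁ : Scheme.{0}) (hF₁ : IsIntegral F₁) (j : F₁ ⟶ X')
    (t : F₁ ⟶ Spec (.of k)) (hsq : IsPullback j t (σ' ≫ q) (Spec.map (CommRingCat.ofHom θ))) (T₁ : Set F₁) (_hT₁cl : IsClosed T₁)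
    (_hT₁irr : IsIrreducible T₁) (_hjT₁ : j '' T₁ = S')
    -- the NOSE block
    (Z : Set F₁) (hZ : IsClosed Z) (_hZT₁ : Z ⊆ T₁) (hT₁Z : ¬ (T₁ ⊆ Z)) (hZinf : Z.Infinite)
    (hZdim : ∀ z : ↥(redSub F₁ Z hZ), IsClosed ({z} : Set ↥(redSub F₁ Z hZ)) →
      ringKrullDim ((redSub F₁ Z hZ).presheaf.stalk z) = ((1 : ℕ) : WithBot ℕ∞))
    (C : X'.IdealSheafData) (hCreg : Scheme.IsRegular C.subscheme) (hCfl : Flat (C.subschemeι ≫ σ' ≫ q))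
    (hCj : C.comap j = vanishingIdeal (⟨Z, hZ⟩ : Closeds F₁)) (hCoff : ∀ c ∈ (C.support : Set X'), ¬ IsGenericPoint (σ' c) Y)
    (X₁ : Scheme.{0}) (τ₁ : X₁ ⟶ X') (hτ₁ : IsBlowup τ₁ C) (hX₁int : IsIntegral X₁) (hX₁noeth : IsLocallyNoetherian X₁)
    (hX₁reg : Scheme.IsRegular X₁) (hX₁dom : IsDominant ((τ₁ ≫ σ') ≫ q)) (F₂ : Scheme.{0}) (hF₂ : IsIntegral F₂) (υ : F₂ ⟶ F₁)
    (hυ : IsBlowup υ (vanishingIdeal (⟨Z, hZ⟩ : Closeds F₁))) (j₂ : F₂ ⟶ X₁) (t₂ : F₂ ⟶ Spec (.of k))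
    (hsq₂ : IsPullback j₂ t₂ ((τ₁ ≫ σ') ≫ q) (Spec.map (CommRingCat.ofHom θ))) (hcomm : j₂ ≫ τ₁ = υ ≫ j)
    (_hexc : (C.comap τ₁).comap j₂ = (vanishingIdeal (⟨Z, hZ⟩ : Closeds F₁)).comap υ)
    (hirr₂ : IsIrreducible (closure (υ ⁻¹' (T₁ \ Z)))) (hCh₁ : Ch X₁ (τ₁ ≫ σ') (j₂ '' closure (υ ⁻¹' (T₁ \ Z))))
    -- ===================== THE ONE NAMED INPUT: (T-k), the registered NEED-FACT instantiated over `q` =====================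
    -- (T-k) the embedded-curve lift at every stage / exceptional surface over `q` (res-L1-w45b-lead-2 …NatTowerRoundFourDefs p594791)
    (hFact : EmbeddedCurveLift O k θ P q)
    -- the Σ-LICENCE at `(O, k, θ)` (res-L1-w45b-stub-2's binder 0196e0c85d2c112d; WIDTH TABLE D12, desk R74 (i))
    (hSL :
      ∀ {P : Scheme.{0}} (X : Scheme.{0}) (σ : X ⟶ P) (q : P ⟶ Spec (.of O)) (𝓔 : X.IdealSheafData),
        IsIntegral X → IsLocallyNoetherian X → Scheme.IsRegular X → IsProper (σ ≫ q) →
        (∀ x : X, (stalkIdeal 𝓔 x).IsPrincipal) → 𝓔 ≠ ⊥ →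
        Scheme.IsRegular 𝓔.subscheme → Flat (𝓔.subschemeι ≫ σ ≫ q) → IsProper (𝓔.subschemeι ≫ σ ≫ q) →
        ∀ (G : Scheme.{0}) (j : G ⟶ X) (t : G ⟶ Spec (.of k)),
          IsPullback j t (σ ≫ q) (Spec.map (CommRingCat.ofHom θ)) →
          ∀ (E : Set G) (hE : IsClosed E), 𝓔.comap j = vanishingIdeal (⟨E, hE⟩ : Closeds G) →
          ∀ (Z : Set G) (hZ : IsClosed Z), Z ⊆ E →
            Set.Finite {x : ↥(redSub G Z hZ) | ¬ IsRegularLocalRing ((redSub G Z hZ).presheaf.stalk x)} →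
            (∀ z : ↥(redSub G Z hZ), IsClosed ({z} : Set ↥(redSub G Z hZ)) →
              ringKrullDim ((redSub G Z hZ).presheaf.stalk z) = ((1 : ℕ) : WithBot ℕ∞)) →
            (∀ (i : redSub G Z hZ ⟶ redSub G E hE), i ≫ redSubι G E hE = redSubι G Z hZ →
              ∀ z : ↥(redSub G Z hZ), IsClosed ({z} : Set ↥(redSub G Z hZ)) →
                ringKrullDim ((redSub G E hE).presheaf.stalk (i z)) = ((2 : ℕ) : WithBot ℕ∞)) →
            (∀ z ∈ Z, IsClosed ({z} : Set G) → ∃ f : G.presheaf.stalk z,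
              stalkIdeal (vanishingIdeal (⟨Z, hZ⟩ : Closeds G)) z =
                  stalkIdeal (vanishingIdeal (⟨E, hE⟩ : Closeds G)) z ⊔ Ideal.span {f} ∧
                f ∉ stalkIdeal (vanishingIdeal (⟨E, hE⟩ : Closeds G)) z ⊔ (maximalIdeal (G.presheaf.stalk z)) ^ 2) →
            DirStepUnobs G E hE Z hZ →
            ∃ C : X.IdealSheafData, 𝓔 ≤ C ∧ Scheme.IsRegular C.subscheme ∧ Flat (C.subschemeι ≫ σ ≫ q) ∧
              C.comap j = vanishingIdeal (⟨Z, hZ⟩ : Closeds G)) :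
    -- ===================== THE CONCLUSION OF HSUB‴(ReachNoseTowerB‴)₃ =====================
    ∀ (F' : Scheme.{0}) (γ' : F' ⟶ F₂) (T' E' K' : Set F'),
      (∃ Es' Ns' : List (Set F'), ∀ R₁ : (∀ G : Scheme.{0}, (G ⟶ F₂) → Set G → Set G → List (Set G) → List (Set G) → Set G → Prop),
        R₁ F₂ (𝟙 F₂) (closure (υ ⁻¹' (T₁ \ Z))) (υ ⁻¹' Z) [] [] ∅ → TowerPtRegB₄ F₂ R₁ → TowerPtRamB₄ F₂ R₁ →
        TowerRoundBTriplePrime F₁ F₂ υ Z hZ R₁ → TowerSecRoundSigma F₁ F₂ υ Z hZ R₁ → R₁ F' γ' T' E' Es' Ns' K') →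
      ∃ (X₉ : Scheme.{0}) (σ₉ : X₉ ⟶ P) (S₉ : Set X₉) (j₉ : F' ⟶ X₉) (t₉ : F' ⟶ Spec (.of k)),
        Ch X₉ σ₉ S₉ ∧ IsIntegral X₉ ∧ IsLocallyNoetherian X₉ ∧ Scheme.IsRegular X₉ ∧ IsDominant (σ₉ ≫ q) ∧
        IsPullback j₉ t₉ (σ₉ ≫ q) (Spec.map (CommRingCat.ofHom θ)) ∧ j₉ '' T' = S₉ ∧ IsClosed T' ∧ IsIrreducible T' ∧ IsIntegral F' := by
  classical
  haveI := hPint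
  haveI := hqprop
  haveI := hqsm
  haveI := hX'noeth
  haveI := hX₁int
  haveI := hX₁noeth
  haveI := hF₂
  haveI := hF₁
  -- the exceptional-surface datum of the engine: `O`-FLATNESS of the upstairs model of the running exceptional surface
  let FE : Tower.RuledDatum P := fun _ _ _ _ _ _ _ _ _ σ _ 𝓔 => Flat (𝓔.subschemeι ≫ σ ≫ q)
  have hFEbirth : ∀ {X X'' : Scheme.{0}} [IsLocallyNoetherian X] (σ : X ⟶ P) (C : X.IdealSheafData) (τ : X'' ⟶ X),
      Scheme.IsRegular X → Scheme.IsRegular C.subscheme → Flat (C.subschemeι ≫ σ ≫ q) → IsBlowup τ C →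
      Flat ((C.comap τ).subschemeι ≫ (τ ≫ σ) ≫ q) := by
    intro X X'' _ σ C τ hXreg hCreg hCflat hτ
    rw [Category.assoc]
    exact flat_exceptional_of_isBlowup_regularCentre O X X'' (σ ≫ q) C hXreg hCreg hCflat τ hτ
  -- `F₁` is locally Noetherian (a closed subscheme of `X'`)
  haveI : IsClosedImmersion (Spec.map (CommRingCat.ofHom θ)) := IsClosedImmersion.spec_of_surjective _ hθ
  haveI : IsClosedImmersion j := MorphismProperty.IsStableUnderBaseChange.of_isPullback hsq.flip inferInstance
  haveI hF₁noeth : IsLocallyNoetherian F₁ := LocallyOfFiniteType.isLocallyNoetherian j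
  -- INV₁‴ (B‴-tower, at the datum `FE`): `Tower.InvB₄` ∧ K-side facts ∧ the carrier-dimension datum ∧ `IsLocallyNoetherian F₉` (the V10 shape of p627628/p627682)
  let INV₁ : ∀ (F₉ : Scheme.{0}) (Z₉ : Set F₉), IsClosed Z₉ → ∀ (F₁₀ : Scheme.{0}), (F₁₀ ⟶ F₉) →
      ∀ G : Scheme.{0}, (G ⟶ F₁₀) → Set G → Set G → List (Set G) → List (Set G) → Set G → Prop :=
    fun F₉ Z₉ hZ₉ F₁₀ υ' G γ T E Es Ns K => (Tower.InvB₄ O k θ P q Y Ch FE F₉ Z₉ hZ₉ F₁₀ υ' G γ T E Es Ns K ∧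
      IsClosed K ∧ K ⊆ closure (K \ E) ∧ K ≠ Set.univ) ∧
      (∀ z : ↥(redSub F₉ Z₉ hZ₉), IsClosed ({z} : Set ↥(redSub F₉ Z₉ hZ₉)) →
        ringKrullDim ((redSub F₉ Z₉ hZ₉).presheaf.stalk z) = ((1 : ℕ) : WithBot ℕ∞)) ∧ IsLocallyNoetherian F₉
  -- (seed): `Tower.inv₂_noseSeed'` at `FE` ⇒ `Inv₃`; the seed surface `υ⁻¹Z` maps ONTO the infinite `Z` ⇒ `¬ NoRound` ⇒ MODEL-CARRYING ⇒ `InvB₄ … [] [] ∅`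
  have hseed : INV₁ F₁ Z hZ F₂ υ F₂ (𝟙 F₂) (closure (υ ⁻¹' (T₁ \ Z))) (υ ⁻¹' Z) [] [] ∅ := by
    refine ⟨?_, hZdim, hF₁noeth⟩
    obtain ⟨h₁, h₂⟩ := Tower.inv₂_noseSeed' O k θ hθ P q Y Ch FE X' σ' hX'noeth hX'reg F₁ j t hsq T₁ Z hZ hT₁Z hZinf C hCreg hCj hCoff X₁ τ₁ hτ₁
      hX₁int hX₁noeth hX₁reg hX₁dom F₂ hF₂ υ hυ j₂ t₂ hsq₂ hcomm hirr₂ hCh₁ (hFEbirth σ' C τ₁ hX'reg hCreg hCfl hτ₁)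
    have h₃ := Tower.inv₂_inv₃ O k θ P q Y Ch FE F₁ Z hZ F₂ υ F₂ (𝟙 F₂) _ _ _ h₁
    -- `¬ NoRound`: the image of `υ⁻¹Z` under `𝟙 ≫ υ` is `Z`, infinite
    have hZne : (vanishingIdeal (⟨Z, hZ⟩ : Closeds F₁) : F₁.IdealSheafData) ≠ ⊥ := fun h => by
      have hsupp : ((vanishingIdeal (⟨Z, hZ⟩ : Closeds F₁) : F₁.IdealSheafData).support : Set F₁) = Z :=
        Scheme.IdealSheafData.coe_support_vanishingIdeal _
      rw [h, Scheme.IdealSheafData.support_bot] at hsupp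
      exact hT₁Z (fun t _ => hsupp ▸ trivial)
    have hsurj : Function.Surjective υ :=
      Summit.ResolutionOfSingularities.ResolutionOfSingularities.Theorems.EquisingularLift.surjective_of_isBlowup hυ hZne
    have hno : ¬ Tower.NoRound υ F₂ (𝟙 F₂) (υ ⁻¹' Z) := by
      intro hfin
      apply hZinf
      have himg : ((𝟙 F₂ ≫ υ) '' (υ ⁻¹' Z) : Set F₁) = Z := by
        rw [Category.id_comp]
        exact Set.image_preimage_eq Z hsurj
      simpa only [Tower.NoRound, himg] using hfin
    obtain ⟨g1, g2, g3, g4, g5, g6, g7, X, σ, S, jG, tG, hCh, hX, hXn, hXr, hdom, hsqG, hTS, hE⟩ := h₃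
    exact ⟨⟨g1, g2, g3, g4, g5, g6, g7, fun F hF => by simp at hF, fun F hF => by simp at hF, X, σ, S, jG, tG, hCh, hX, hXn, hXr, hdom,
      hsqG, hTS, fun hE' => Tower.exc₄_of_exc₃_of_not_noRound O P q Y FE (hE hE') hno, fun F hF => by simp at hF⟩, h₂⟩
  -- the three step closures of the B‴ tower on `INV₁‴` (this seat, p627628 / p627682)
  have hptreg : ∀ (F₉ : Scheme.{0}) (Z₉ : Set F₉) (hZ₉ : IsClosed Z₉) (F₁₀ : Scheme.{0}) (υ' : F₁₀ ⟶ F₉),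
      TowerPtRegB₄ F₁₀ (INV₁ F₉ Z₉ hZ₉ F₁₀ υ') := fun F₉ Z₉ hZ₉ F₁₀ υ' =>
    Tower.towerPtRegB₄_invB₁_FE O k θ hθ P q Y hYsp hYirr hYcl hPnoeth hPreg Ch hChStep hChSplit F₉ Z₉ hZ₉ F₁₀ υ'
  have hptram : ∀ (F₉ : Scheme.{0}) (Z₉ : Set F₉) (hZ₉ : IsClosed Z₉) (F₁₀ : Scheme.{0}) (υ' : F₁₀ ⟶ F₉),
      TowerPtRamB₄ F₁₀ (INV₁ F₉ Z₉ hZ₉ F₁₀ υ') := fun F₉ Z₉ hZ₉ F₁₀ υ' =>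
    Tower.towerPtRamB₄_invB₁_FE O k θ hθ P q Y hYsp hYirr hYcl hPnoeth hPreg Ch hChStep hChSplit F₉ Z₉ hZ₉ F₁₀ υ'
  have hround : ∀ (F₉ : Scheme.{0}) (Z₉ : Set F₉) (hZ₉ : IsClosed Z₉) (F₁₀ : Scheme.{0}) (υ' : F₁₀ ⟶ F₉),
      TowerRoundBTriplePrime F₉ F₁₀ υ' Z₉ hZ₉ (INV₁ F₉ Z₉ hZ₉ F₁₀ υ') := fun F₉ Z₉ hZ₉ F₁₀ υ' =>
    Tower.towerRoundBTriplePrime_invB₄_of_fact' O k θ hθ P q Y hYsp hYirr hYcl hPnoeth hPreg Ch hChStep hChSplit hFact Z₉ hZ₉ υ'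
  -- the FOURTH closure (D12): the Σ-section hosted round from the licence
  have hsec : ∀ (F₉ : Scheme.{0}) (Z₉ : Set F₉) (hZ₉ : IsClosed Z₉) (F₁₀ : Scheme.{0}) (υ' : F₁₀ ⟶ F₉),
      TowerSecRoundSigma F₉ F₁₀ υ' Z₉ hZ₉ (INV₁ F₉ Z₉ hZ₉ F₁₀ υ') := fun F₉ Z₉ hZ₉ F₁₀ υ' =>
    Tower.towerSecRoundSigma_invB₁_of_licence O k θ hθ P q Y hYsp hYirr hYcl hPnoeth hPreg Ch hChStep hChSplit hSL Z₉ hZ₉ υ'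
  -- the closure at `R₁ := INV₁ F₁ Z hZ F₂ υ`, then (final) := `Tower.invB₄_final ∘ And.left`
  intro F' γ' T' E' K' hcl
  obtain ⟨Es', Ns', hcl⟩ := hcl
  have h' : INV₁ F₁ Z hZ F₂ υ F' γ' T' E' Es' Ns' K' :=
    hcl (INV₁ F₁ Z hZ F₂ υ) hseed (hptreg F₁ Z hZ F₂ υ) (hptram F₁ Z hZ F₂ υ) (hround F₁ Z hZ F₂ υ) (hsec F₁ Z hZ F₂ υ)
  exact Tower.invB₄_final O k θ P q Y Ch FE F₁ Z hZ F₂ υ F' γ' T' E' Es' Ns' K' h'.1.1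

end Summit.ResolutionOfSingularities.ResolutionOfSingularities.Cruxes.EquisingularLiftNat.Sections

end
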